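import Mathlib.Analysis.Calculus.ParametricIntegral
import Mathlib.MeasureTheory.Integral.IntegralEqImproper
import Mathlib.Analysis.SpecialFunctions.ImproperIntegrals
import Mathlib.Analysis.Complex.RealDeriv
import HarnessLib

/-!
# Green's theorem on a vertically simple region of the upper half-plane with exponential decay
# at `i∞` (the Stokes step of Haberland's formula)

Theorems only (no definitions, no named facts). This is the real-analysis input of the proof of
**Haberland's formula** for the Petersson product of two cusp forms (V. Paşol, A. A. Popa,
*Modular forms and period polynomials*, Proc. LMS 107 (2013), Thm. 3.2 and §8.2 [PasolPopa2013];
W. Kohnen, D. Zagier, *Modular forms with rational periods* (1984), p. 243): Stokes' theorem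
`∫_𝔉 d(P dz̄) = ∮_{∂𝔉} P dz̄` on the standard fundamental domain
`𝔉 = {|x| ≤ 1/2, x² + y² ≥ 1}` of `SL₂(ℤ)`, for a `C¹` function `P` decaying exponentially at `i∞`.
We prove it for every **vertically simple region** `{a ≤ x ≤ b, y > φ(x)}` (`φ` of class `C¹` on
`[a, b]`, bounded below by `m > 0`) and every `P : ℂ → ℂ` which is real-`C¹` on the open upper
half-plane with `‖P‖, ‖DP‖ ≤ C e^{-c y}` on `[a, b] × [m, ∞)`:

* `setIntegral_Ioi_fderiv_I_eq` — the vertical fundamental theorem of calculus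
  `∫_{φ(x)}^∞ ∂P/∂y (x + it) dt = -P(x + iφ(x))`;
* `hasDerivAt_setIntegral_Ioi_moving` — the Leibniz rule for the moving half-line
  `d/dx ∫_{φ(x)}^∞ P(x + it) dt = ∫_{φ(x)}^∞ ∂P/∂x (x + it) dt - φ'(x) P(x + iφ(x))`
  (differentiation under the integral sign, Mathlib's
  `hasDerivAt_integral_of_dominated_loc_of_deriv_le`, after the substitution `t = φ(x) + s`);
* `integral_setIntegral_Ioi_fderiv_one_eq` — hence, by the fundamental theorem of calculus in `x`,
  `∫_a^b ∫_{φ(x)}^∞ ∂P/∂x = I(b) - I(a) + ∫_a^b φ'(x) P(x + iφ(x)) dx`, `I(x) = ∫_{φ(x)}^∞ P(x+it) dt`;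
* `integral_setIntegral_Ioi_fderiv_I_eq` — and `∫_a^b ∫_{φ(x)}^∞ ∂P/∂y = -∫_a^b P(x + iφ(x)) dx`;
* `green_dzbar` — **Green's theorem for the form `P dz̄`**:
  `∫_a^b ∫_{φ(x)}^∞ (-i ∂P/∂x - ∂P/∂y)(x+it) dt dx
     = ∫_a^b P(x + iφ(x)) (1 - iφ'(x)) dx - i I(b) + i I(a)`,
  i.e. `∫_𝔇 ∂P/∂z dz ∧ dz̄ = ∮_{∂𝔇} P dz̄` for `𝔇 = {a ≤ x ≤ b, y ≥ φ(x)}` (bottom curve from left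
  to right, right side upwards, left side downwards; `dz ∧ dz̄ = -2i dx dy`,
  `∂/∂z = (∂/∂x - i∂/∂y)/2`).

All integrals over the region are iterated integrals `∫_a^b (∫_{φ(x)}^∞ … dt) dx`; the
identification with the invariant integral over `ModularGroup.fd` is done where it is used.

## References

* [PasolPopa2013] V. Paşol, A. A. Popa, Proc. LMS 107 (2013) 713–743, arXiv:1202.5802: proof of
  Thm. 3.2 and §8.2 (Stokes' theorem on a fundamental domain).
* [KohnenZagier1984] W. Kohnen, D. Zagier, *Modular forms with rational periods*, in: Modular forms
  (Durham, 1983), 197–249: p. 243.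
-/

noncomputable section

open MeasureTheory Set Filter Topology Complex

namespace Literature.NumberTheory.EllipticCurves.ModularForms

namespace GreenUHP

/-! ### Elementary lemmas -/

/-- Translation of a Bochner integral on a half-line: `∫_{t > d} h(t) dt = ∫_{s > 0} h(d + s) ds`. [folklore] -/
theorem setIntegral_Ioi_eq_setIntegral_Ioi_zero_add {E : Type*} [NormedAddCommGroup E] [NormedSpace ℝ E]
    (h : ℝ → E) (d : ℝ) : ∫ t in Ioi d, h t = ∫ s in Ioi (0 : ℝ), h (d + s) := by
  have := (measurePreserving_add_left volume d).setIntegral_preimage_emb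
    (measurableEmbedding_addLeft d) h (Ioi d)
  rw [preimage_const_add_Ioi, sub_self] at this
  exact this.symm

/-- `e^{-ct} → 0` as `t → ∞` for `c > 0`. [folklore] -/
theorem tendsto_exp_neg_mul_atTop {c : ℝ} (hc : 0 < c) :
    Tendsto (fun t : ℝ ↦ Real.exp (-c * t)) atTop (𝓝 0) := by
  have h1 : Tendsto (fun t : ℝ ↦ c * t) atTop atTop := tendsto_id.const_mul_atTop hc
  have h2 : Tendsto (fun t : ℝ ↦ -c * t) atTop atBot := by
    have := tendsto_neg_atTop_atBot.comp h1
    refine this.congr fun t ↦ ?_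
    simp [neg_mul]
  exact Real.tendsto_exp_atBot.comp h2

/-- The point `x + it` has real part `x` and imaginary part `t`. [folklore] -/
theorem re_im_ofReal_add_mul_I (x t : ℝ) :
    ((x : ℂ) + t * I).re = x ∧ ((x : ℂ) + t * I).im = t := by
  constructor <;> simp

/-- The vertical path `t ↦ x + it` has derivative `i`. [folklore] -/
theorem hasDerivAt_vertical (x t : ℝ) :
    HasDerivAt (fun s : ℝ ↦ (x : ℂ) + s * I) I t := by
  have h := ((hasDerivAt_id t).ofReal_comp).mul_const I
  simpa using h.const_add (x : ℂ)

/-- The path `x ↦ x + i(φ(x) + s)` has derivative `1 + iφ'(x)`. [folklore] -/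
theorem hasDerivAt_graphPath {φ : ℝ → ℝ} {φ' x : ℝ} (hφ : HasDerivAt φ φ' x) (s : ℝ) :
    HasDerivAt (fun u : ℝ ↦ (u : ℂ) + ((φ u + s : ℝ) : ℂ) * I) (1 + (φ' : ℂ) * I) x := by
  have h1 : HasDerivAt (fun u : ℝ ↦ ((id u : ℝ) : ℂ)) ((1 : ℝ) : ℂ) x := (hasDerivAt_id x).ofReal_comp
  have h2 : HasDerivAt (fun u : ℝ ↦ ((φ u + s : ℝ) : ℂ) * I) ((φ' : ℂ) * I) x :=
    ((hφ.add_const s).ofReal_comp).mul_const I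
  have e : (fun u : ℝ ↦ (u : ℂ) + ((φ u + s : ℝ) : ℂ) * I) =
      ((fun u : ℝ ↦ ((id u : ℝ) : ℂ)) + fun u : ℝ ↦ ((φ u + s : ℝ) : ℂ) * I) := rfl
  rw [e]
  refine (h1.add h2).congr_deriv ?_
  simp

end GreenUHP

open GreenUHP

/-! ### The setting -/

section Setting

variable {P : ℂ → ℂ} {P' : ℂ → (ℂ →L[ℝ] ℂ)} {φ φ' : ℝ → ℝ} {a b m C c : ℝ}

/-- Continuity of `P` on the open upper half-plane (it is differentiable there). [folklore] -/
theorem GreenUHP.continuousAt_of_hasFDerivAt (hP : ∀ z : ℂ, 0 < z.im → HasFDerivAt P (P' z) z)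
    {z : ℂ} (hz : 0 < z.im) : ContinuousAt P z :=
  (hP z hz).continuousAt

/-- The integrand `t ↦ P(x + it)` is continuous on `(d, ∞)` for `d ≥ 0`. [folklore] -/
theorem GreenUHP.continuousOn_vertical (hP : ∀ z : ℂ, 0 < z.im → HasFDerivAt P (P' z) z)
    (x : ℝ) {d : ℝ} (hd : 0 ≤ d) : ContinuousOn (fun t : ℝ ↦ P ((x : ℂ) + t * I)) (Ioi d) := by
  intro t ht
  have hz : 0 < ((x : ℂ) + t * I).im := by simp; exact lt_of_le_of_lt hd ht
  have hcomp : ContinuousAt (fun s : ℝ ↦ P ((x : ℂ) + s * I)) t :=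
    ContinuousAt.comp (g := P) (f := fun s : ℝ ↦ (x : ℂ) + s * I) (hP _ hz).continuousAt
      (hasDerivAt_vertical x t).continuousAt
  exact hcomp.continuousWithinAt

/-- The integrand `t ↦ DP(x + it) v` is continuous on `(d, ∞)` for `d ≥ 0`. [folklore] -/
theorem GreenUHP.continuousOn_vertical_fderiv (hP' : ContinuousOn P' {z : ℂ | 0 < z.im})
    (x : ℝ) {d : ℝ} (hd : 0 ≤ d) (v : ℂ) :
    ContinuousOn (fun t : ℝ ↦ P' ((x : ℂ) + t * I) v) (Ioi d) := by
  have hpath : Continuous fun t : ℝ ↦ (x : ℂ) + t * I := by fun_prop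
  have hmaps : MapsTo (fun t : ℝ ↦ (x : ℂ) + t * I) (Ioi d) {z : ℂ | 0 < z.im} := by
    intro t ht
    simp only [mem_setOf_eq]
    simp
    exact lt_of_le_of_lt hd ht
  have h1 : ContinuousOn (fun t : ℝ ↦ P' ((x : ℂ) + t * I)) (Ioi d) :=
    hP'.comp hpath.continuousOn hmaps
  exact (ContinuousLinearMap.apply ℝ ℂ v).continuous.comp_continuousOn h1

/-- Exponential bound for the integrand on a vertical ray above height `m`. [folklore] -/
theorem GreenUHP.norm_vertical_le
    (hbP : ∀ z : ℂ, z.re ∈ Icc a b → m ≤ z.im → ‖P z‖ ≤ C * Real.exp (-c * z.im))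
    {x : ℝ} (hx : x ∈ Icc a b) {t : ℝ} (ht : m ≤ t) :
    ‖P ((x : ℂ) + t * I)‖ ≤ C * Real.exp (-c * t) := by
  have := hbP ((x : ℂ) + t * I) (by simpa using hx) (by simpa using ht)
  simpa using this

/-- Exponential bound for the derivative applied to a vector, on a vertical ray above height `m`. [folklore] -/
theorem GreenUHP.norm_vertical_fderiv_le
    (hbP' : ∀ z : ℂ, z.re ∈ Icc a b → m ≤ z.im → ‖P' z‖ ≤ C * Real.exp (-c * z.im))
    {x : ℝ} (hx : x ∈ Icc a b) {t : ℝ} (ht : m ≤ t) (v : ℂ) :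
    ‖P' ((x : ℂ) + t * I) v‖ ≤ C * ‖v‖ * Real.exp (-c * t) := by
  have h := hbP' ((x : ℂ) + t * I) (by simpa using hx) (by simpa using ht)
  simp only [add_im, ofReal_im, mul_im, ofReal_re, I_im, mul_one, I_re, mul_zero, add_zero,
    zero_add] at h
  calc ‖P' ((x : ℂ) + t * I) v‖ ≤ ‖P' ((x : ℂ) + t * I)‖ * ‖v‖ := ContinuousLinearMap.le_opNorm _ _
    _ ≤ C * Real.exp (-c * t) * ‖v‖ := by gcongr
    _ = C * ‖v‖ * Real.exp (-c * t) := by ring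

/-- Integrability of `t ↦ DP(x+it) v` on `(d, ∞)`, `d ≥ m`. [folklore] -/
theorem GreenUHP.integrableOn_vertical_fderiv (hP' : ContinuousOn P' {z : ℂ | 0 < z.im})
    (hbP' : ∀ z : ℂ, z.re ∈ Icc a b → m ≤ z.im → ‖P' z‖ ≤ C * Real.exp (-c * z.im))
    (hm : 0 < m) (hc : 0 < c) {x : ℝ} (hx : x ∈ Icc a b) {d : ℝ} (hd : m ≤ d) (v : ℂ) :
    IntegrableOn (fun t : ℝ ↦ P' ((x : ℂ) + t * I) v) (Ioi d) := by
  have hmeas : AEStronglyMeasurable (fun t : ℝ ↦ P' ((x : ℂ) + t * I) v) (volume.restrict (Ioi d)) :=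
    (continuousOn_vertical_fderiv hP' x (hm.le.trans hd) v).aestronglyMeasurable measurableSet_Ioi
  refine Integrable.mono' (((integrableOn_exp_mul_Ioi (neg_lt_zero.mpr hc) d).const_mul (C * ‖v‖)))
    hmeas ?_
  refine (ae_restrict_iff' measurableSet_Ioi).mpr (Eventually.of_forall fun t ht ↦ ?_)
  have := norm_vertical_fderiv_le hbP' hx (hd.trans (le_of_lt ht)) v
  simpa [neg_mul] using this

/-- Integrability of `t ↦ P(x+it)` on `(d, ∞)`, `d ≥ m`. [folklore] -/
theorem GreenUHP.integrableOn_vertical (hP : ∀ z : ℂ, 0 < z.im → HasFDerivAt P (P' z) z)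
    (hbP : ∀ z : ℂ, z.re ∈ Icc a b → m ≤ z.im → ‖P z‖ ≤ C * Real.exp (-c * z.im))
    (hm : 0 < m) (hc : 0 < c) {x : ℝ} (hx : x ∈ Icc a b) {d : ℝ} (hd : m ≤ d) :
    IntegrableOn (fun t : ℝ ↦ P ((x : ℂ) + t * I)) (Ioi d) := by
  have hmeas : AEStronglyMeasurable (fun t : ℝ ↦ P ((x : ℂ) + t * I)) (volume.restrict (Ioi d)) :=
    (continuousOn_vertical hP x (hm.le.trans hd)).aestronglyMeasurable measurableSet_Ioi
  refine Integrable.mono' (((integrableOn_exp_mul_Ioi (neg_lt_zero.mpr hc) d).const_mul C)) hmeas ?_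
  refine (ae_restrict_iff' measurableSet_Ioi).mpr (Eventually.of_forall fun t ht ↦ ?_)
  have := norm_vertical_le hbP hx (hd.trans (le_of_lt ht))
  simpa [neg_mul] using this

/-! ### The vertical fundamental theorem of calculus -/

/-- **`∫_{d}^∞ ∂P/∂y (x + it) dt = -P(x + id)`** for `d ≥ m`: the fundamental theorem of calculus on
the vertical ray, `P → 0` at `i∞`. [folklore] -/
theorem setIntegral_Ioi_fderiv_I_eq (hP : ∀ z : ℂ, 0 < z.im → HasFDerivAt P (P' z) z)
    (hP' : ContinuousOn P' {z : ℂ | 0 < z.im})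
    (hbP : ∀ z : ℂ, z.re ∈ Icc a b → m ≤ z.im → ‖P z‖ ≤ C * Real.exp (-c * z.im))
    (hbP' : ∀ z : ℂ, z.re ∈ Icc a b → m ≤ z.im → ‖P' z‖ ≤ C * Real.exp (-c * z.im))
    (hm : 0 < m) (hc : 0 < c) {x : ℝ} (hx : x ∈ Icc a b) {d : ℝ} (hd : m ≤ d) :
    ∫ t in Ioi d, P' ((x : ℂ) + t * I) I = -P ((x : ℂ) + d * I) := by
  have hderiv : ∀ t ∈ Ioi d, HasDerivAt (fun s : ℝ ↦ P ((x : ℂ) + s * I)) (P' ((x : ℂ) + t * I) I) t := by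
    intro t ht
    have hz : 0 < ((x : ℂ) + t * I).im := by simp; exact hm.trans_le (hd.trans (le_of_lt ht))
    exact (hP _ hz).comp_hasDerivAt t (hasDerivAt_vertical x t)
  have hcont : ContinuousWithinAt (fun s : ℝ ↦ P ((x : ℂ) + s * I)) (Ici d) d := by
    have hz : 0 < ((x : ℂ) + d * I).im := by simp; exact hm.trans_le hd
    have hcomp : ContinuousAt (fun s : ℝ ↦ P ((x : ℂ) + s * I)) d :=
      ContinuousAt.comp (g := P) (f := fun s : ℝ ↦ (x : ℂ) + s * I) (hP _ hz).continuousAt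
        (hasDerivAt_vertical x d).continuousAt
    exact hcomp.continuousWithinAt
  have hlim : Tendsto (fun s : ℝ ↦ P ((x : ℂ) + s * I)) atTop (𝓝 0) := by
    have h0 : Tendsto (fun t : ℝ ↦ C * Real.exp (-c * t)) atTop (𝓝 0) := by
      simpa using (tendsto_exp_neg_mul_atTop hc).const_mul C
    refine squeeze_zero_norm' ?_ h0
    filter_upwards [eventually_ge_atTop m] with t ht using norm_vertical_le hbP hx ht
  rw [integral_Ioi_of_hasDerivAt_of_tendsto hcont hderiv
    (integrableOn_vertical_fderiv hP' hbP' hm hc hx hd I) hlim, zero_sub]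

/-! ### The moving vertical integral and the Leibniz rule -/

/-- The point `x + i(φ(x) + s)`, `s > 0`, lies above height `m` when `φ(x) ≥ m`. [folklore] -/
theorem GreenUHP.im_graphPoint (φ : ℝ → ℝ) (x s : ℝ) :
    ((x : ℂ) + ((φ x + s : ℝ) : ℂ) * I).im = φ x + s ∧ ((x : ℂ) + ((φ x + s : ℝ) : ℂ) * I).re = x := by
  constructor <;> simp

/-- `∫_{φ(x)}^∞ h(x + it) dt = ∫_0^∞ h(x + i(φ(x) + s)) ds`. [folklore] -/
theorem GreenUHP.setIntegral_Ioi_moving_eq (h : ℂ → ℂ) (φ : ℝ → ℝ) (x : ℝ) :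
    ∫ t in Ioi (φ x), h ((x : ℂ) + t * I) = ∫ s in Ioi (0 : ℝ), h ((x : ℂ) + ((φ x + s : ℝ) : ℂ) * I) :=
  setIntegral_Ioi_eq_setIntegral_Ioi_zero_add (fun t : ℝ ↦ h ((x : ℂ) + t * I)) (φ x)

/-- Differentiability in `x` of the shifted integrand `x ↦ P(x + i(φ(x) + s))`. [folklore] -/
theorem GreenUHP.hasDerivAt_shifted (hP : ∀ z : ℂ, 0 < z.im → HasFDerivAt P (P' z) z)
    {x s : ℝ} (hφ : HasDerivAt φ (φ' x) x) (hpos : 0 < φ x + s) :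
    HasDerivAt (fun u : ℝ ↦ P ((u : ℂ) + ((φ u + s : ℝ) : ℂ) * I))
      (P' ((x : ℂ) + ((φ x + s : ℝ) : ℂ) * I) (1 + (φ' x : ℂ) * I)) x := by
  have hz : 0 < ((x : ℂ) + ((φ x + s : ℝ) : ℂ) * I).im := by
    rw [(im_graphPoint φ x s).1]; exact hpos
  exact (hP _ hz).comp_hasDerivAt x (hasDerivAt_graphPath hφ s)

/-- Continuity in `s` of the shifted integrand on `(0, ∞)`. [folklore] -/
theorem GreenUHP.continuousOn_shifted (hP : ∀ z : ℂ, 0 < z.im → HasFDerivAt P (P' z) z)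
    {x : ℝ} (hφx : 0 ≤ φ x) :
    ContinuousOn (fun s : ℝ ↦ P ((x : ℂ) + ((φ x + s : ℝ) : ℂ) * I)) (Ioi 0) := by
  intro s hs
  have hz : 0 < ((x : ℂ) + ((φ x + s : ℝ) : ℂ) * I).im := by
    rw [(im_graphPoint φ x s).1]; exact add_pos_of_nonneg_of_pos hφx hs
  have hpath : Continuous fun s : ℝ ↦ (x : ℂ) + ((φ x + s : ℝ) : ℂ) * I := by fun_prop
  exact (ContinuousAt.comp (g := P) (f := fun s : ℝ ↦ (x : ℂ) + ((φ x + s : ℝ) : ℂ) * I)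
    (hP _ hz).continuousAt hpath.continuousAt).continuousWithinAt

/-- Continuity in `s` of the shifted derivative on `(0, ∞)`. [folklore] -/
theorem GreenUHP.continuousOn_shifted_fderiv (hP' : ContinuousOn P' {z : ℂ | 0 < z.im})
    {x : ℝ} (hφx : 0 ≤ φ x) (v : ℂ) :
    ContinuousOn (fun s : ℝ ↦ P' ((x : ℂ) + ((φ x + s : ℝ) : ℂ) * I) v) (Ioi 0) := by
  have hpath : Continuous fun s : ℝ ↦ (x : ℂ) + ((φ x + s : ℝ) : ℂ) * I := by fun_prop
  have hmaps : MapsTo (fun s : ℝ ↦ (x : ℂ) + ((φ x + s : ℝ) : ℂ) * I) (Ioi 0) {z : ℂ | 0 < z.im} := by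
    intro s hs
    simp only [mem_setOf_eq, (im_graphPoint φ x s).1]
    exact add_pos_of_nonneg_of_pos hφx hs
  exact (ContinuousLinearMap.apply ℝ ℂ v).continuous.comp_continuousOn
    (hP'.comp hpath.continuousOn hmaps)

/-- Exponential bound for the shifted integrand: `‖P(x + i(φ(x)+s))‖ ≤ C e^{-cs}` for `s > 0`. [folklore] -/
theorem GreenUHP.norm_shifted_le
    (hbP : ∀ z : ℂ, z.re ∈ Icc a b → m ≤ z.im → ‖P z‖ ≤ C * Real.exp (-c * z.im)) (hC : 0 ≤ C)
    (hc : 0 < c) {x : ℝ} (hx : x ∈ Icc a b) (hφx : m ≤ φ x) (hm : 0 < m) {s : ℝ} (hs : 0 < s) :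
    ‖P ((x : ℂ) + ((φ x + s : ℝ) : ℂ) * I)‖ ≤ C * Real.exp (-c * s) := by
  have h := hbP ((x : ℂ) + ((φ x + s : ℝ) : ℂ) * I) (by rw [(im_graphPoint φ x s).2]; exact hx)
    (by rw [(im_graphPoint φ x s).1]; linarith)
  rw [(im_graphPoint φ x s).1] at h
  refine h.trans ?_
  have : Real.exp (-c * (φ x + s)) ≤ Real.exp (-c * s) := Real.exp_le_exp.mpr (by nlinarith)
  exact mul_le_mul_of_nonneg_left this hC

/-- Exponential bound for the shifted derivative: `‖DP(x + i(φ(x)+s)) v‖ ≤ C ‖v‖ e^{-cs}`. [folklore] -/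
theorem GreenUHP.norm_shifted_fderiv_le
    (hbP' : ∀ z : ℂ, z.re ∈ Icc a b → m ≤ z.im → ‖P' z‖ ≤ C * Real.exp (-c * z.im)) (hC : 0 ≤ C)
    (hc : 0 < c) {x : ℝ} (hx : x ∈ Icc a b) (hφx : m ≤ φ x) (hm : 0 < m) {s : ℝ} (hs : 0 < s) (v : ℂ) :
    ‖P' ((x : ℂ) + ((φ x + s : ℝ) : ℂ) * I) v‖ ≤ C * ‖v‖ * Real.exp (-c * s) := by
  have h := hbP' ((x : ℂ) + ((φ x + s : ℝ) : ℂ) * I) (by rw [(im_graphPoint φ x s).2]; exact hx)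
    (by rw [(im_graphPoint φ x s).1]; linarith)
  rw [(im_graphPoint φ x s).1] at h
  have hexp : Real.exp (-c * (φ x + s)) ≤ Real.exp (-c * s) := Real.exp_le_exp.mpr (by nlinarith)
  calc ‖P' ((x : ℂ) + ((φ x + s : ℝ) : ℂ) * I) v‖
      ≤ ‖P' ((x : ℂ) + ((φ x + s : ℝ) : ℂ) * I)‖ * ‖v‖ := ContinuousLinearMap.le_opNorm _ _
    _ ≤ C * Real.exp (-c * (φ x + s)) * ‖v‖ := by gcongr
    _ ≤ C * Real.exp (-c * s) * ‖v‖ := by gcongr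
    _ = C * ‖v‖ * Real.exp (-c * s) := by ring

/-- Integrability of the shifted integrand on `(0, ∞)`. [folklore] -/
theorem GreenUHP.integrableOn_shifted (hP : ∀ z : ℂ, 0 < z.im → HasFDerivAt P (P' z) z)
    (hbP : ∀ z : ℂ, z.re ∈ Icc a b → m ≤ z.im → ‖P z‖ ≤ C * Real.exp (-c * z.im)) (hC : 0 ≤ C)
    (hm : 0 < m) (hc : 0 < c) {x : ℝ} (hx : x ∈ Icc a b) (hφx : m ≤ φ x) :
    IntegrableOn (fun s : ℝ ↦ P ((x : ℂ) + ((φ x + s : ℝ) : ℂ) * I)) (Ioi 0) := by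
  refine Integrable.mono' ((integrableOn_exp_mul_Ioi (neg_lt_zero.mpr hc) 0).const_mul C)
    ((continuousOn_shifted hP (hm.le.trans hφx)).aestronglyMeasurable measurableSet_Ioi) ?_
  refine (ae_restrict_iff' measurableSet_Ioi).mpr (Eventually.of_forall fun s hs ↦ ?_)
  simpa [neg_mul] using norm_shifted_le hbP hC hc hx hφx hm hs

/-- Integrability of the shifted derivative on `(0, ∞)`. [folklore] -/
theorem GreenUHP.integrableOn_shifted_fderiv (hP' : ContinuousOn P' {z : ℂ | 0 < z.im})
    (hbP' : ∀ z : ℂ, z.re ∈ Icc a b → m ≤ z.im → ‖P' z‖ ≤ C * Real.exp (-c * z.im)) (hC : 0 ≤ C)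
    (hm : 0 < m) (hc : 0 < c) {x : ℝ} (hx : x ∈ Icc a b) (hφx : m ≤ φ x) (v : ℂ) :
    IntegrableOn (fun s : ℝ ↦ P' ((x : ℂ) + ((φ x + s : ℝ) : ℂ) * I) v) (Ioi 0) := by
  refine Integrable.mono' ((integrableOn_exp_mul_Ioi (neg_lt_zero.mpr hc) 0).const_mul (C * ‖v‖))
    ((continuousOn_shifted_fderiv hP' (hm.le.trans hφx) v).aestronglyMeasurable measurableSet_Ioi) ?_
  refine (ae_restrict_iff' measurableSet_Ioi).mpr (Eventually.of_forall fun s hs ↦ ?_)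
  simpa [neg_mul] using norm_shifted_fderiv_le hbP' hC hc hx hφx hm hs v

/-- **The Leibniz rule for the moving vertical integral**: for `x₀ ∈ (a, b)`,
`d/dx|_{x₀} ∫_{φ(x)}^∞ P(x + it) dt = ∫_{φ(x₀)}^∞ ∂P/∂x(x₀ + it) dt - φ'(x₀) P(x₀ + iφ(x₀))`. [folklore] -/
theorem hasDerivAt_setIntegral_Ioi_moving (hP : ∀ z : ℂ, 0 < z.im → HasFDerivAt P (P' z) z)
    (hP' : ContinuousOn P' {z : ℂ | 0 < z.im})
    (hbP : ∀ z : ℂ, z.re ∈ Icc a b → m ≤ z.im → ‖P z‖ ≤ C * Real.exp (-c * z.im))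
    (hbP' : ∀ z : ℂ, z.re ∈ Icc a b → m ≤ z.im → ‖P' z‖ ≤ C * Real.exp (-c * z.im)) (hC : 0 ≤ C)
    (hm : 0 < m) (hc : 0 < c) (hφ : ∀ x ∈ Icc a b, HasDerivAt φ (φ' x) x)
    (hφ' : ContinuousOn φ' (Icc a b)) (hφm : ∀ x ∈ Icc a b, m ≤ φ x) {x₀ : ℝ} (hx₀ : x₀ ∈ Ioo a b) :
    HasDerivAt (fun x : ℝ ↦ ∫ t in Ioi (φ x), P ((x : ℂ) + t * I))
      ((∫ t in Ioi (φ x₀), P' ((x₀ : ℂ) + t * I) 1) - (φ' x₀ : ℂ) * P ((x₀ : ℂ) + φ x₀ * I)) x₀ := by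
  have hx₀' : x₀ ∈ Icc a b := Ioo_subset_Icc_self hx₀
  obtain ⟨M, hM⟩ := isCompact_Icc.exists_bound_of_continuousOn hφ'
  have hM0 : 0 ≤ M := (norm_nonneg _).trans (hM x₀ hx₀')
  set F : ℝ → ℝ → ℂ := fun x s ↦ P ((x : ℂ) + ((φ x + s : ℝ) : ℂ) * I) with hF
  set F' : ℝ → ℝ → ℂ := fun x s ↦ P' ((x : ℂ) + ((φ x + s : ℝ) : ℂ) * I) (1 + (φ' x : ℂ) * I)
    with hF'
  have hdiff : ∀ᵐ s ∂(volume.restrict (Ioi (0 : ℝ))), ∀ x ∈ Icc a b,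
      HasDerivAt (fun u ↦ F u s) (F' x s) x := by
    refine (ae_restrict_iff' measurableSet_Ioi).mpr (Eventually.of_forall fun s hs x hx ↦ ?_)
    exact hasDerivAt_shifted hP (hφ x hx) (by linarith [hφm x hx, mem_Ioi.mp hs])
  have hnorm1 : ∀ x ∈ Icc a b, ‖(1 : ℂ) + (φ' x : ℂ) * I‖ ≤ 1 + M := by
    intro x hx
    calc ‖(1 : ℂ) + (φ' x : ℂ) * I‖ ≤ ‖(1 : ℂ)‖ + ‖(φ' x : ℂ) * I‖ := norm_add_le _ _
      _ = 1 + ‖φ' x‖ := by simp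
      _ ≤ 1 + M := by linarith [hM x hx]
  have hbound : ∀ᵐ s ∂(volume.restrict (Ioi (0 : ℝ))), ∀ x ∈ Icc a b,
      ‖F' x s‖ ≤ C * (1 + M) * Real.exp (-c * s) := by
    refine (ae_restrict_iff' measurableSet_Ioi).mpr (Eventually.of_forall fun s hs x hx ↦ ?_)
    have h1 := norm_shifted_fderiv_le hbP' hC hc hx (hφm x hx) hm (mem_Ioi.mp hs)
      (1 + (φ' x : ℂ) * I)
    refine h1.trans ?_
    have : C * ‖(1 : ℂ) + (φ' x : ℂ) * I‖ ≤ C * (1 + M) := mul_le_mul_of_nonneg_left (hnorm1 x hx) hC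
    exact mul_le_mul_of_nonneg_right this (Real.exp_pos _).le
  have key := hasDerivAt_integral_of_dominated_loc_of_deriv_le
    (μ := volume.restrict (Ioi (0 : ℝ))) (F := F) (F' := F') (x₀ := x₀) (s := Icc a b)
    (bound := fun s ↦ C * (1 + M) * Real.exp (-c * s)) (Icc_mem_nhds hx₀.1 hx₀.2)
    ?_ (integrableOn_shifted hP hbP hC hm hc hx₀' (hφm x₀ hx₀'))
    ((continuousOn_shifted_fderiv hP' (hm.le.trans (hφm x₀ hx₀')) _).aestronglyMeasurable
      measurableSet_Ioi)
    hbound ((integrableOn_exp_mul_Ioi (neg_lt_zero.mpr hc) 0).const_mul (C * (1 + M))) hdiff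
  swap
  · filter_upwards [Icc_mem_nhds hx₀.1 hx₀.2] with x hx
    exact (continuousOn_shifted hP (hm.le.trans (hφm x hx))).aestronglyMeasurable measurableSet_Ioi
  -- identify the function and the derivative
  have hfun : (fun x : ℝ ↦ ∫ t in Ioi (φ x), P ((x : ℂ) + t * I)) =
      fun x : ℝ ↦ ∫ s in Ioi (0 : ℝ), F x s := by
    funext x
    exact setIntegral_Ioi_moving_eq P φ x
  rw [hfun]
  refine key.2.congr_deriv ?_
  -- `∫ F' x₀ = ∫ ∂ₓP + φ'(x₀) ∫ ∂_yP = ∫ ∂ₓP - φ'(x₀) P(x₀ + iφ(x₀))`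
  have hsplit : ∀ s, F' x₀ s = P' ((x₀ : ℂ) + ((φ x₀ + s : ℝ) : ℂ) * I) 1 +
      (φ' x₀) • P' ((x₀ : ℂ) + ((φ x₀ + s : ℝ) : ℂ) * I) I := by
    intro s
    simp only [hF']
    rw [map_add, show ((φ' x₀ : ℝ) : ℂ) * I = (φ' x₀) • I by rw [Complex.real_smul], map_smul]
  simp_rw [hsplit]
  have hint2 : Integrable (fun s : ℝ ↦ (φ' x₀) • P' ((x₀ : ℂ) + ((φ x₀ + s : ℝ) : ℂ) * I) I)
      (volume.restrict (Ioi (0 : ℝ))) :=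
    (integrableOn_shifted_fderiv hP' hbP' hC hm hc hx₀' (hφm x₀ hx₀') I).smul (φ' x₀)
  rw [integral_add (integrableOn_shifted_fderiv hP' hbP' hC hm hc hx₀' (hφm x₀ hx₀') 1) hint2,
    integral_smul, ← setIntegral_Ioi_moving_eq (fun z ↦ P' z 1) φ x₀,
    ← setIntegral_Ioi_moving_eq (fun z ↦ P' z I) φ x₀,
    setIntegral_Ioi_fderiv_I_eq hP hP' hbP hbP' hm hc hx₀' (hφm x₀ hx₀'), Complex.real_smul]
  ring

/-- **Continuity of the moving vertical integral** `x ↦ ∫_{φ(x)}^∞ P(x + it) dt` on `[a, b]`. [folklore] -/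
theorem continuousOn_setIntegral_Ioi_moving (hP : ∀ z : ℂ, 0 < z.im → HasFDerivAt P (P' z) z)
    (hbP : ∀ z : ℂ, z.re ∈ Icc a b → m ≤ z.im → ‖P z‖ ≤ C * Real.exp (-c * z.im)) (hC : 0 ≤ C)
    (hm : 0 < m) (hc : 0 < c) (hφ : ∀ x ∈ Icc a b, HasDerivAt φ (φ' x) x)
    (hφm : ∀ x ∈ Icc a b, m ≤ φ x) :
    ContinuousOn (fun x : ℝ ↦ ∫ t in Ioi (φ x), P ((x : ℂ) + t * I)) (Icc a b) := by
  have hfun : (fun x : ℝ ↦ ∫ t in Ioi (φ x), P ((x : ℂ) + t * I)) =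
      fun x : ℝ ↦ ∫ s in Ioi (0 : ℝ), P ((x : ℂ) + ((φ x + s : ℝ) : ℂ) * I) := by
    funext x
    exact setIntegral_Ioi_moving_eq P φ x
  rw [hfun]
  refine continuousOn_of_dominated (bound := fun s ↦ C * Real.exp (-c * s)) ?_ ?_
    ((integrableOn_exp_mul_Ioi (neg_lt_zero.mpr hc) 0).const_mul C) ?_
  · intro x hx
    exact (continuousOn_shifted hP (hm.le.trans (hφm x hx))).aestronglyMeasurable measurableSet_Ioi
  · intro x hx
    refine (ae_restrict_iff' measurableSet_Ioi).mpr (Eventually.of_forall fun s hs ↦ ?_)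
    exact norm_shifted_le hbP hC hc hx (hφm x hx) hm hs
  · refine (ae_restrict_iff' measurableSet_Ioi).mpr (Eventually.of_forall fun s hs x hx ↦ ?_)
    exact (hasDerivAt_shifted hP (hφ x hx)
      (by linarith [hφm x hx, mem_Ioi.mp hs])).continuousAt.continuousWithinAt

/-- **Continuity of `x ↦ ∫_{φ(x)}^∞ DP(x + it) v dt`** on `[a, b]`. [folklore] -/
theorem continuousOn_setIntegral_Ioi_moving_fderiv (hP' : ContinuousOn P' {z : ℂ | 0 < z.im})
    (hbP' : ∀ z : ℂ, z.re ∈ Icc a b → m ≤ z.im → ‖P' z‖ ≤ C * Real.exp (-c * z.im)) (hC : 0 ≤ C)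
    (hm : 0 < m) (hc : 0 < c) (hφ : ∀ x ∈ Icc a b, HasDerivAt φ (φ' x) x)
    (hφm : ∀ x ∈ Icc a b, m ≤ φ x) (v : ℂ) :
    ContinuousOn (fun x : ℝ ↦ ∫ t in Ioi (φ x), P' ((x : ℂ) + t * I) v) (Icc a b) := by
  have hfun : (fun x : ℝ ↦ ∫ t in Ioi (φ x), P' ((x : ℂ) + t * I) v) =
      fun x : ℝ ↦ ∫ s in Ioi (0 : ℝ), P' ((x : ℂ) + ((φ x + s : ℝ) : ℂ) * I) v := by
    funext x
    exact setIntegral_Ioi_moving_eq (fun z ↦ P' z v) φ x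
  rw [hfun]
  refine continuousOn_of_dominated (bound := fun s ↦ C * ‖v‖ * Real.exp (-c * s)) ?_ ?_
    ((integrableOn_exp_mul_Ioi (neg_lt_zero.mpr hc) 0).const_mul (C * ‖v‖)) ?_
  · intro x hx
    exact (continuousOn_shifted_fderiv hP' (hm.le.trans (hφm x hx)) v).aestronglyMeasurable
      measurableSet_Ioi
  · intro x hx
    refine (ae_restrict_iff' measurableSet_Ioi).mpr (Eventually.of_forall fun s hs ↦ ?_)
    exact norm_shifted_fderiv_le hbP' hC hc hx (hφm x hx) hm hs v
  · refine (ae_restrict_iff' measurableSet_Ioi).mpr (Eventually.of_forall fun s hs ↦ ?_)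
    have hφc : ContinuousOn φ (Icc a b) := fun x hx ↦ (hφ x hx).continuousAt.continuousWithinAt
    have hpath : ContinuousOn (fun x : ℝ ↦ (x : ℂ) + ((φ x + s : ℝ) : ℂ) * I) (Icc a b) := by
      fun_prop
    have hmaps : MapsTo (fun x : ℝ ↦ (x : ℂ) + ((φ x + s : ℝ) : ℂ) * I) (Icc a b)
        {z : ℂ | 0 < z.im} := by
      intro x hx
      simp only [mem_setOf_eq, (im_graphPoint φ x s).1]
      linarith [hφm x hx, mem_Ioi.mp hs]
    exact (ContinuousLinearMap.apply ℝ ℂ v).continuous.comp_continuousOn (hP'.comp hpath hmaps)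

/-! ### Green's theorem on the region `{a ≤ x ≤ b, y ≥ φ(x)}` -/

/-- **`∫_a^b ∫_{φ(x)}^∞ ∂P/∂y (x+it) dt dx = -∫_a^b P(x + iφ(x)) dx`** (the `∂/∂y` half of Green's
theorem: the vertical fundamental theorem of calculus, fibrewise). [folklore] -/
theorem integral_setIntegral_Ioi_fderiv_I_eq (hP : ∀ z : ℂ, 0 < z.im → HasFDerivAt P (P' z) z)
    (hP' : ContinuousOn P' {z : ℂ | 0 < z.im})
    (hbP : ∀ z : ℂ, z.re ∈ Icc a b → m ≤ z.im → ‖P z‖ ≤ C * Real.exp (-c * z.im))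
    (hbP' : ∀ z : ℂ, z.re ∈ Icc a b → m ≤ z.im → ‖P' z‖ ≤ C * Real.exp (-c * z.im))
    (hm : 0 < m) (hc : 0 < c) (hab : a ≤ b) (hφm : ∀ x ∈ Icc a b, m ≤ φ x) :
    ∫ x in a..b, ∫ t in Ioi (φ x), P' ((x : ℂ) + t * I) I =
      -∫ x in a..b, P ((x : ℂ) + φ x * I) := by
  rw [← intervalIntegral.integral_neg]
  refine intervalIntegral.integral_congr fun x hx ↦ ?_
  rw [uIcc_of_le hab] at hx
  exact setIntegral_Ioi_fderiv_I_eq hP hP' hbP hbP' hm hc hx (hφm x hx)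

/-- **`∫_a^b ∫_{φ(x)}^∞ ∂P/∂x (x+it) dt dx = I(b) - I(a) + ∫_a^b φ'(x) P(x + iφ(x)) dx`**,
`I(x) = ∫_{φ(x)}^∞ P(x + it) dt` (the `∂/∂x` half of Green's theorem: the Leibniz rule
`hasDerivAt_setIntegral_Ioi_moving` integrated over `[a, b]`). [folklore] -/
theorem integral_setIntegral_Ioi_fderiv_one_eq (hP : ∀ z : ℂ, 0 < z.im → HasFDerivAt P (P' z) z)
    (hP' : ContinuousOn P' {z : ℂ | 0 < z.im})
    (hbP : ∀ z : ℂ, z.re ∈ Icc a b → m ≤ z.im → ‖P z‖ ≤ C * Real.exp (-c * z.im))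
    (hbP' : ∀ z : ℂ, z.re ∈ Icc a b → m ≤ z.im → ‖P' z‖ ≤ C * Real.exp (-c * z.im)) (hC : 0 ≤ C)
    (hm : 0 < m) (hc : 0 < c) (hab : a ≤ b) (hφ : ∀ x ∈ Icc a b, HasDerivAt φ (φ' x) x)
    (hφ' : ContinuousOn φ' (Icc a b)) (hφm : ∀ x ∈ Icc a b, m ≤ φ x) :
    ∫ x in a..b, ∫ t in Ioi (φ x), P' ((x : ℂ) + t * I) 1 =
      (∫ t in Ioi (φ b), P ((b : ℂ) + t * I)) - (∫ t in Ioi (φ a), P ((a : ℂ) + t * I)) +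
        ∫ x in a..b, (φ' x : ℂ) * P ((x : ℂ) + φ x * I) := by
  have hφc : ContinuousOn φ (Icc a b) := fun x hx ↦ (hφ x hx).continuousAt.continuousWithinAt
  -- continuity of the boundary term `x ↦ φ'(x) P(x + iφ(x))`
  have hBc : ContinuousOn (fun x : ℝ ↦ (φ' x : ℂ) * P ((x : ℂ) + φ x * I)) (Icc a b) := by
    refine (continuous_ofReal.comp_continuousOn hφ').mul ?_
    have hpath : ContinuousOn (fun x : ℝ ↦ (x : ℂ) + φ x * I) (Icc a b) := by fun_prop
    have hmaps : MapsTo (fun x : ℝ ↦ (x : ℂ) + φ x * I) (Icc a b) {z : ℂ | 0 < z.im} := by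
      intro x hx
      simp only [mem_setOf_eq]
      simp
      linarith [hφm x hx]
    have hPc : ContinuousOn P {z : ℂ | 0 < z.im} := fun z hz ↦ (hP z hz).continuousAt.continuousWithinAt
    exact hPc.comp hpath hmaps
  have hJc := continuousOn_setIntegral_Ioi_moving_fderiv hP' hbP' hC hm hc hφ hφm (1 : ℂ)
  have hFTC := intervalIntegral.integral_eq_sub_of_hasDerivAt_of_le hab
    (continuousOn_setIntegral_Ioi_moving hP hbP hC hm hc hφ hφm)
    (fun x hx ↦ hasDerivAt_setIntegral_Ioi_moving hP hP' hbP hbP' hC hm hc hφ hφ' hφm hx)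
    ((hJc.sub hBc).intervalIntegrable_of_Icc hab)
  rw [intervalIntegral.integral_sub (hJc.intervalIntegrable_of_Icc hab)
    (hBc.intervalIntegrable_of_Icc hab)] at hFTC
  linear_combination hFTC

/-- **Green's theorem for the form `P dz̄` on `𝔇 = {a ≤ x ≤ b, y ≥ φ(x)}`** (`P` real-`C¹` on the
upper half-plane, `‖P‖, ‖DP‖ ≤ Ce^{-cy}` on `[a,b] × [m,∞)`, `φ ≥ m > 0` of class `C¹`):
`∫_𝔇 ∂P/∂z dz ∧ dz̄ = ∮_{∂𝔇} P dz̄`, i.e.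
`∫_a^b ∫_{φ(x)}^∞ (-i ∂P/∂x - ∂P/∂y)(x + it) dt dx
   = ∫_a^b P(x + iφ(x)) (1 - iφ'(x)) dx - i∫_{φ(b)}^∞ P(b + it) dt + i∫_{φ(a)}^∞ P(a + it) dt`
(bottom curve `x ↦ x + iφ(x)` from `a` to `b` with `dz̄ = (1 - iφ') dx`; right side upwards and
left side downwards with `dz̄ = ∓ i dt`; `dz ∧ dz̄ = -2i dx dy`, `∂/∂z = ½(∂/∂x - i ∂/∂y)`). This is
the Stokes step in the proofs of Haberland's formula (Paşol–Popa Thm. 3.2, §8.2; Kohnen–Zagier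
p. 243). [cite: PasolPopa2013, Thm. 3.2 (proof) and §8.2] -/
theorem green_dzbar (hP : ∀ z : ℂ, 0 < z.im → HasFDerivAt P (P' z) z)
    (hP' : ContinuousOn P' {z : ℂ | 0 < z.im})
    (hbP : ∀ z : ℂ, z.re ∈ Icc a b → m ≤ z.im → ‖P z‖ ≤ C * Real.exp (-c * z.im))
    (hbP' : ∀ z : ℂ, z.re ∈ Icc a b → m ≤ z.im → ‖P' z‖ ≤ C * Real.exp (-c * z.im)) (hC : 0 ≤ C)
    (hm : 0 < m) (hc : 0 < c) (hab : a ≤ b) (hφ : ∀ x ∈ Icc a b, HasDerivAt φ (φ' x) x)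
    (hφ' : ContinuousOn φ' (Icc a b)) (hφm : ∀ x ∈ Icc a b, m ≤ φ x) :
    ∫ x in a..b, ∫ t in Ioi (φ x), (-I * P' ((x : ℂ) + t * I) 1 - P' ((x : ℂ) + t * I) I) =
      (∫ x in a..b, P ((x : ℂ) + φ x * I) * (1 - (φ' x : ℂ) * I)) -
        I * (∫ t in Ioi (φ b), P ((b : ℂ) + t * I)) + I * (∫ t in Ioi (φ a), P ((a : ℂ) + t * I)) := by
  have hφc : ContinuousOn φ (Icc a b) := fun x hx ↦ (hφ x hx).continuousAt.continuousWithinAt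
  -- fibrewise splitting of the inner integral
  have hinner : ∀ x ∈ Icc a b,
      ∫ t in Ioi (φ x), (-I * P' ((x : ℂ) + t * I) 1 - P' ((x : ℂ) + t * I) I) =
        -I * (∫ t in Ioi (φ x), P' ((x : ℂ) + t * I) 1) - ∫ t in Ioi (φ x), P' ((x : ℂ) + t * I) I := by
    intro x hx
    have h1 := integrableOn_vertical_fderiv hP' hbP' hm hc hx (hφm x hx) 1
    have hI := integrableOn_vertical_fderiv hP' hbP' hm hc hx (hφm x hx) I
    rw [integral_sub (h1.const_mul (-I)) hI, integral_const_mul]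
  rw [intervalIntegral.integral_congr (fun x hx ↦ hinner x (by rwa [uIcc_of_le hab] at hx))]
  -- continuity of the two fibre integrals in `x`
  have hJ1 := continuousOn_setIntegral_Ioi_moving_fderiv hP' hbP' hC hm hc hφ hφm (1 : ℂ)
  have hJI := continuousOn_setIntegral_Ioi_moving_fderiv hP' hbP' hC hm hc hφ hφm I
  rw [intervalIntegral.integral_sub ((hJ1.intervalIntegrable_of_Icc hab).const_mul (-I))
    (hJI.intervalIntegrable_of_Icc hab), intervalIntegral.integral_const_mul,
    integral_setIntegral_Ioi_fderiv_one_eq hP hP' hbP hbP' hC hm hc hab hφ hφ' hφm,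
    integral_setIntegral_Ioi_fderiv_I_eq hP hP' hbP hbP' hm hc hab hφm]
  -- the boundary integrand `P(x+iφ(x))(1 - iφ'(x)) = P(..) - i φ'(x) P(..)`
  have hPbc : ContinuousOn (fun x : ℝ ↦ P ((x : ℂ) + φ x * I)) (Icc a b) := by
    have hpath : ContinuousOn (fun x : ℝ ↦ (x : ℂ) + φ x * I) (Icc a b) := by fun_prop
    have hmaps : MapsTo (fun x : ℝ ↦ (x : ℂ) + φ x * I) (Icc a b) {z : ℂ | 0 < z.im} := by
      intro x hx
      simp only [mem_setOf_eq]
      simp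
      linarith [hφm x hx]
    have hPc : ContinuousOn P {z : ℂ | 0 < z.im} := fun z hz ↦ (hP z hz).continuousAt.continuousWithinAt
    exact hPc.comp hpath hmaps
  have hBc : ContinuousOn (fun x : ℝ ↦ (φ' x : ℂ) * P ((x : ℂ) + φ x * I)) (Icc a b) :=
    (continuous_ofReal.comp_continuousOn hφ').mul hPbc
  have hsplit : ∫ x in a..b, P ((x : ℂ) + φ x * I) * (1 - (φ' x : ℂ) * I) =
      (∫ x in a..b, P ((x : ℂ) + φ x * I)) - I * ∫ x in a..b, (φ' x : ℂ) * P ((x : ℂ) + φ x * I) := by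
    rw [← intervalIntegral.integral_const_mul, ← intervalIntegral.integral_sub
      (hPbc.intervalIntegrable_of_Icc hab) ((hBc.intervalIntegrable_of_Icc hab).const_mul I)]
    refine intervalIntegral.integral_congr fun x _ ↦ ?_
    ring
  rw [hsplit]
  ring

end Setting

end Literature.NumberTheory.EllipticCurves.ModularForms
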